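import Summits.FinalStateConjecture.FinalStateConjecture.Theorems.PhaseMixingCaptureCaptureSufficesC2StubSoftShieldedScriLeafTransferAux
import HarnessLib

/-!
# Crux `PhaseMixingCapture.CaptureSufficesC2` (stmt-FinalStateConjecture-14986), line `Sketch`,
# stub `stub_softShieldedScri` — support file 2b: the LEAF TRANSFER

**Far-origin sojourn completeness of a realised leaf development ascends to the ambient Cauchy
development** (`hasCompleteNullInfinity_of_leaf`).  This is the generic, Kerr-free step (c) of
`stub_softShieldedScri`; it generalises the landed `stub_scriTransfer` of crux 9952 (transfer along
an embedding over a SUB-DATUM) to an embedding over a LEAF lying in the causal past of the data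
hypersurface, the ray origins on the data hypersurface being joined to the leaf by PRE-SEGMENTS
of the rays themselves.

Setting.  `𝓜` is a Cauchy development of the datum `D` on `X`; `𝒮` is ANY data embedding of a
datum `D'` on `N` (the leaf datum), realised in `𝓜` by a smooth, isometric, time-orientation
preserving map `χ : 𝒮 → 𝓜`; the leaf `χ(ι_S N)` lies in `J⁻(ι X)`; `𝒮` has complete future null
infinity in Christodoulou's sojourn form as seen from the origins `A ⊆ N`
(`DataEmbedding.HasCompleteFutureNullInfinityFrom`); and the FOOT-POINT HYPOTHESIS holds: there is
`c > 0` such that for every compact `C ⊆ N` there is a compact `K ⊆ X` such that every normalised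
null ray `γ : dom` of `𝓜` from a point `ι x`, `x ∉ K`, passes at some parameter `−t₀ ≤ 0` through
a leaf point `χ(ι_S p)`, `p ∈ A ∖ C`, with `g(γ'(−t₀), dχ ν_S(p)) = −λ`, `0 < λ ≤ c` (bounded
renormalisation factor), its pre-segment `γ[−t₀, 0)` avoiding `J⁺(χ(ι_S C))`.
Conclusion: `Summit.FinalStateConjecture.HasCompleteNullInfinity 𝓜`.

Proof.  `B₀ := ι⁻¹ J⁺(χ ι_S B₀^S)` (compact: `isCompact_preimage_embed_causalFuture`); given
`s > 0` take `B₁^S` for `c s`, `C := B₀^S ∪ B₁^S`, `B₁ := K(C)`.  For a ray `γ` from `ι x`, `x ∉ K`,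
the affinely reparametrised ray `u ↦ γ(u/λ − t₀)` is a normalised null ray of `𝓜` from the leaf
point (future null velocity propagates along geodesics,
`IsGeodesicOn.isNull_and_isFutureDirected_velocity`; affine reparametrisations of maximal geodesics
are maximal, `isMaximalGeodesicOn_comp_affine`), which lifts to a normalised null ray `γ'` of `𝒮`
from `p` (`exists_isNormalisedNullRayFrom_leaf_lift`).  Completeness of `γ'` gives completeness of
`γ`; a sojourn parameter `u ≥ 0` of `γ'` in `J⁺_𝒮(ι_S B₀^S)` gives the parameter `t = u/λ − t₀` of
`γ` with `γ t ∈ J⁺_𝓜(χ ι_S B₀^S)` (`image_causalFuture_subset`), hence `t ≥ 0` (pre-segment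
avoidance) and `γ t ∈ J⁺(ι x) ⊆ J⁺(ι X)` (the ray is a future causal curve), so that a causal curve
from the leaf (in `J⁻(ι X)`) to `γ t` crosses `ι X` inside `ι B₀` (`exists_embed_between`):
`γ t ∈ J⁺(ι B₀)`.  Lebesgue measure scales by `λ ≤ c` under `u ↦ u/λ − t₀`, whence the sojourn of `γ`
is `≥ (c s)/λ ≥ s`.

References: D. Christodoulou, CQG 16 (1999) A23, pp. A26–A27; M. Dafermos, I. Rodnianski,
arXiv:0811.0354, §2.6.2; B. O'Neill, *Semi-Riemannian geometry* (1983), Ch. 3, Prop. 3.24,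
Lemma 3.21, Ch. 14, pp. 402–403, Lemma 14.29; S. W. Hawking, G. F. R. Ellis (1973), Prop. 6.6.6.
-/

set_option linter.dupNamespace false

noncomputable section

open scoped Manifold ContDiff Topology
open Set Function Filter Topology MeasureTheory Literature.Geometry.Lorentzian

namespace Summit.FinalStateConjecture.FinalStateConjecture.Theorems.CaptureSufficesC2.Sketch

namespace SoftShieldedScri

universe v

section LeafTransfer

variable {X : Type} [TopologicalSpace X] [ChartedSpace E3 X] [IsManifold (𝓡 3) ∞ X]
  [ConnectedSpace X] {D : InitialDataSet (𝓡 3) X}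
  {N : Type v} [TopologicalSpace N] [ChartedSpace E3 N] [IsManifold (𝓡 3) ∞ N]
  [ConnectedSpace N] {D' : InitialDataSet (𝓡 3) N}

/-- A nonzero multiple of a null vector is null (`g(cv, cv) = c² g(v, v) = 0`, `cv ≠ 0`).
O'Neill 1983, Ch. 3, p. 56. [folklore] -/
theorem isNull_smul (𝓜 : DataEmbedding D) {x : 𝓜.carrier} {v : TangentSpace (𝓡 4) x}
    (hv : 𝓜.metric.IsNull v) {c : ℝ} (hc : c ≠ 0) : 𝓜.metric.IsNull (c • v) := by
  refine ⟨?_, smul_ne_zero hc hv.2⟩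
  have h := hv.1
  simp only [map_smul, smul_apply, smul_eq_mul, h, mul_zero]

/-- **THE LEAF TRANSFER.**  Let `𝓜` be a Cauchy development of `D` on `X`, `𝒮` a data embedding
of a datum `D'` on `N`, realised in `𝓜` by a smooth, isometric, time-orientation preserving
`χ : 𝒮 → 𝓜` whose leaf `χ(ι_S N)` lies in `J⁻(ι X)`; assume `𝒮` has complete future null
infinity in the sojourn form from the origins `A ⊆ N`, and the foot-point hypothesis `hfoot`:
for some `c > 0` and every compact `C ⊆ N` there is a compact `K ⊆ X` such that every normalised
null ray `γ : dom` of `𝓜` from `ι x`, `x ∉ K`, passes at a parameter `−t₀ ≤ 0` through a leaf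
point `χ(ι_S p)`, `p ∈ A ∖ C`, with `g(γ'(−t₀), dχ ν_S p) = −λ`, `0 < λ ≤ c`, the pre-segment
`γ[−t₀, 0)` avoiding `J⁺(χ(ι_S C))`.  Then `𝓜` has complete future null infinity in
Christodoulou's sojourn form from all origins (`Summit.FinalStateConjecture.HasCompleteNullInfinity`).
See the module docstring for the proof.  Christodoulou, CQG 16 (1999) A23, pp. A26–A27;
Dafermos–Rodnianski arXiv:0811.0354, §2.6.2; O'Neill 1983, Ch. 3, Prop. 3.24, Ch. 14,
pp. 402–403. [cite: Christodoulou1999, pp. A26–A27] -/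
theorem hasCompleteNullInfinity_of_leaf (𝓜 : CauchyDevelopment D) (𝒮 : DataEmbedding D')
    {χ : 𝒮.carrier → 𝓜.carrier} (hχ : ContMDiff (𝓡 4) (𝓡 4) ∞ χ)
    (hiso : 𝒮.metric.IsIsometricImmersion 𝓜.metric.toPseudoRiemannianMetric χ)
    (hτ : 𝒮.timeOrientation.PreservesTimeOrientation χ 𝓜.timeOrientation)
    (hpast : ∀ p : N, χ (𝒮.embed p) ∈ 𝓜.metric.causalPast 𝓜.timeOrientation (range 𝓜.embed))
    {A : Set N} (h𝒮 : 𝒮.HasCompleteFutureNullInfinityFrom A)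
    (hfoot : ∀ [𝓜.metric.HasLeviCivita], ∃ c : ℝ, 0 < c ∧ ∀ C : Set N, IsCompact C →
      ∃ K : Set X, IsCompact K ∧ ∀ x ∉ K, ∀ (γ : ℝ → 𝓜.carrier) (dom : Set ℝ),
        𝓜.metric.IsNormalisedNullRayFrom 𝓜.timeOrientation 𝓜.embed 𝓜.normal x γ dom →
        ∃ (t₀ lam : ℝ) (p : N), 0 ≤ t₀ ∧ 0 < lam ∧ lam ≤ c ∧ p ∈ A ∧ p ∉ C ∧ -t₀ ∈ dom ∧
          γ (-t₀) = χ (𝒮.embed p) ∧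
          𝓜.metric.val (χ (𝒮.embed p)) (velocity (𝓡 4) γ (-t₀))
            (mfderiv (𝓡 4) (𝓡 4) χ (𝒮.embed p) (𝒮.normal p)) = -lam ∧
          ∀ t ∈ dom, -t₀ ≤ t → t < 0 →
            γ t ∉ 𝓜.metric.causalFuture 𝓜.timeOrientation (χ '' (𝒮.embed '' C))) :
    Summit.FinalStateConjecture.HasCompleteNullInfinity 𝓜 := by
  intro inst𝓜
  haveI : 𝒮.metric.HasLeviCivita := 𝒮.metric.toPseudoRiemannianMetric.hasLeviCivita
  haveI := contMDiffCovariantDerivative_leviCivita 𝓜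
  have hn2 : (2 : ℕ∞ω) ≤ ∞ := WithTop.coe_le_coe.mpr le_top
  have hχd : MDifferentiable (𝓡 4) (𝓡 4) χ := hχ.mdifferentiable (by simp)
  obtain ⟨c, hc, hC⟩ := hfoot
  obtain ⟨B₀S, hB₀S, hS⟩ := h𝒮
  -- the reference set `B₀ := ι⁻¹ J⁺(χ ι_S B₀^S)`
  set Kc : Set 𝓜.carrier := χ '' (𝒮.embed '' B₀S) with hKc_def
  have hKc : IsCompact Kc :=
    (hB₀S.image 𝒮.isSmoothEmbedding.isEmbedding.continuous).image hχ.continuous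
  set B₀ : Set X := 𝓜.embed ⁻¹' 𝓜.metric.causalFuture 𝓜.timeOrientation Kc with hB₀_def
  have hB₀ : IsCompact B₀ := 𝓜.isCompact_preimage_embed_causalFuture hKc
  refine ⟨B₀, hB₀, fun s hs ↦ ?_⟩
  obtain ⟨B₁S, hB₁S, hS₁⟩ := hS (c * s) (mul_pos hc hs)
  obtain ⟨K, hK, hKray⟩ := hC (B₀S ∪ B₁S) (hB₀S.union hB₁S)
  refine ⟨K, hK, fun x hx γ dom hγ ↦ ?_⟩
  obtain ⟨t₀, lam, p, ht₀, hlam, hlamc, hpA, hpC, ht₀dom, hfootpt, hnormval, havoid⟩ :=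
    hKray x hx γ dom hγ
  -- the ray is a future causal curve with future null velocity throughout
  have hmax := hγ.isMaximalGeodesicOn
  have hopen : IsOpen dom := hmax.isOpen
  have hoc : dom.OrdConnected := hmax.2.1
  have hgeo : IsGeodesicOn 𝓜.metric.leviCivita γ dom := hmax.isGeodesicOn
  have hnf : ∀ t ∈ dom, 𝓜.metric.IsNull (velocity (𝓡 4) γ t) ∧
      𝓜.timeOrientation.IsFutureDirected (velocity (𝓡 4) γ t) := fun t ht ↦
    IsGeodesicOn.isNull_and_isFutureDirected_velocity 𝓜.metric 𝓜.timeOrientation hopen hoc hgeo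
      hγ.zero_mem hγ.isNull_velocity hγ.isFutureDirected_velocity ht
  have hcausal : 𝓜.metric.IsFutureCausalCurveOn 𝓜.timeOrientation γ dom := fun t ht ↦
    ⟨IsGeodesicOn.mdifferentiableAt_holds hgeo ht, (hnf t ht).2⟩
  -- the affinely reparametrised ray `u ↦ γ (u/λ − t₀)` from the leaf point
  set f : ℝ → ℝ := fun u ↦ lam⁻¹ * u + -t₀ with hf_def
  set γt : ℝ → 𝓜.carrier := fun u ↦ γ (lam⁻¹ * u + -t₀) with hγt_def
  set domt : Set ℝ := (fun u ↦ lam⁻¹ * u + -t₀) ⁻¹' dom with hdomt_def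
  have hlam0 : lam⁻¹ ≠ 0 := inv_ne_zero hlam.ne'
  have hf0 : lam⁻¹ * 0 + -t₀ = -t₀ := by ring
  have hvel : velocity (𝓡 4) γt 0 = lam⁻¹ • velocity (𝓡 4) γ (lam⁻¹ * 0 + -t₀) :=
    velocity_comp_affine γ lam⁻¹ (-t₀) 0
  have key : ∀ (t : ℝ) (_ : t = -t₀),
      𝓜.metric.IsNull (lam⁻¹ • velocity (𝓡 4) γ t) ∧
        𝓜.timeOrientation.IsFutureDirected (lam⁻¹ • velocity (𝓡 4) γ t) := by
    rintro t rfl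
    exact ⟨isNull_smul 𝓜.toDataEmbedding (hnf _ ht₀dom).1 hlam0,
      (hnf _ ht₀dom).2.smul (inv_pos.2 hlam)⟩
  obtain ⟨hnull', hfd'⟩ := key _ hf0
  -- the normalisation against the pushed-forward leaf normal
  have key' : ∀ (v : TangentSpace (𝓡 4) (χ (𝒮.embed p))),
      𝓜.metric.val (χ (𝒮.embed p)) v (mfderiv (𝓡 4) (𝓡 4) χ (𝒮.embed p) (𝒮.normal p)) = -lam →
      𝓜.metric.val (χ (𝒮.embed p)) (lam⁻¹ • v)
        (mfderiv (𝓡 4) (𝓡 4) χ (𝒮.embed p) (𝒮.normal p)) = -1 := by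
    intro v hv
    rw [map_smul, smul_apply, hv, smul_eq_mul, mul_neg, inv_mul_cancel₀ hlam.ne']
  have key'' : ∀ (t : ℝ) (_ : t = -t₀),
      𝓜.metric.val (χ (𝒮.embed p)) (lam⁻¹ • velocity (𝓡 4) γ t)
        (mfderiv (𝓡 4) (𝓡 4) χ (𝒮.embed p) (𝒮.normal p)) = -1 := by
    rintro t rfl
    exact key' _ hnormval
  have hnorm' := key'' _ hf0
  have hγt : 𝓜.metric.IsNormalisedNullRayFrom 𝓜.timeOrientation (χ ∘ 𝒮.embed)
      (fun q ↦ mfderiv (𝓡 4) (𝓡 4) χ (𝒮.embed q) (𝒮.normal q)) p γt domt := by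
    refine ⟨isMaximalGeodesicOn_comp_affine hmax hlam0 (-t₀), ?_, ?_, ?_, ?_, ?_⟩
    · show lam⁻¹ * 0 + -t₀ ∈ dom
      rw [hf0]; exact ht₀dom
    · show γ (lam⁻¹ * 0 + -t₀) = χ (𝒮.embed p)
      rw [hf0]; exact hfootpt
    · rw [hvel]; exact hnull'
    · rw [hvel]; exact hfd'
    · show 𝓜.metric.val (χ (𝒮.embed p)) (velocity (𝓡 4) γt 0)
          (mfderiv (𝓡 4) (𝓡 4) χ (𝒮.embed p) (𝒮.normal p)) = -1
      rw [hvel]; exact hnorm'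
  -- lift it to the leaf development
  obtain ⟨γ', dom', hγ', hdom', hagree⟩ :=
    exists_isNormalisedNullRayFrom_leaf_lift 𝓜.toDataEmbedding 𝒮 hχ hiso hτ hγt
  rcases hS₁ p hpA (fun h ↦ hpC (Or.inr h)) γ' dom' hγ' with h | h
  · -- completeness ascends
    refine Or.inl fun hb ↦ h ?_
    obtain ⟨B, hB⟩ := hb
    refine ⟨lam * (B + t₀), fun u hu ↦ ?_⟩
    have hu' : lam⁻¹ * u + -t₀ ≤ B := hB (hdom' hu)
    have h1 : lam⁻¹ * u ≤ B + t₀ := by linarith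
    calc u = lam * (lam⁻¹ * u) := by rw [← mul_assoc, mul_inv_cancel₀ hlam.ne', one_mul]
      _ ≤ lam * (B + t₀) := mul_le_mul_of_nonneg_left h1 hlam.le
  · -- the sojourn ascends, up to the factor `λ ≤ c`
    refine Or.inr ?_
    set Tset : Set ℝ := {t ∈ dom | 0 ≤ t ∧
      γ t ∈ 𝓜.metric.causalFuture 𝓜.timeOrientation (𝓜.embed '' B₀)} with hTset_def
    -- every sojourn parameter of `γ'` is carried to a sojourn parameter of `γ`
    have hsub : {u ∈ dom' | 0 ≤ u ∧ γ' u ∈ 𝒮.metric.causalFuture 𝒮.timeOrientation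
        (𝒮.embed '' B₀S)} ⊆ (fun u ↦ lam⁻¹ * u + -t₀) ⁻¹' Tset := by
      rintro u ⟨hu, hu0, huJ⟩
      have htdom : lam⁻¹ * u + -t₀ ∈ dom := hdom' hu
      -- `γ (u/λ − t₀) = χ (γ' u) ∈ J⁺(χ ι_S B₀^S)`
      have hγeq : γ (lam⁻¹ * u + -t₀) = χ (γ' u) := (hagree u hu).symm
      have hJK : γ (lam⁻¹ * u + -t₀) ∈ 𝓜.metric.causalFuture 𝓜.timeOrientation Kc := by
        rw [hγeq]
        exact LorentzianMetric.image_causalFuture_subset hχd hτ hiso.2 _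
          (mem_image_of_mem χ huJ)
      -- the parameter is nonnegative: the pre-segment avoids `J⁺(χ ι_S C)`
      have hge : -t₀ ≤ lam⁻¹ * u + -t₀ := by
        have : 0 ≤ lam⁻¹ * u := mul_nonneg (inv_pos.2 hlam).le hu0
        linarith
      have ht0 : 0 ≤ lam⁻¹ * u + -t₀ := by
        by_contra hneg
        push Not at hneg
        refine havoid _ htdom hge hneg (LorentzianMetric.causalFuture_mono ?_ hJK)
        rw [hKc_def]
        exact image_mono (image_mono subset_union_left)
      refine ⟨htdom, ht0, ?_⟩
      -- `γ t ∈ J⁺(ι x) ⊆ J⁺(ι X)`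
      have hfut : γ (lam⁻¹ * u + -t₀) ∈
          𝓜.metric.causalFuture 𝓜.timeOrientation (range 𝓜.embed) := by
        have h1 := IsFutureCausalCurveOn.apply_mem_causalFuture (τ := 𝓜.timeOrientation) ht0
          (hcausal.mono (hoc.out hγ.zero_mem htdom))
        rw [hγ.apply_zero] at h1
        exact LorentzianMetric.causalFuture_mono (singleton_subset_iff.2 (mem_range_self x)) h1
      -- a causal curve from the leaf to `γ t` crosses `ι X` inside `ι B₀`
      rw [LorentzianMetric.causalFuture_eq_biUnion] at hJK
      simp only [mem_iUnion, exists_prop] at hJK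
      obtain ⟨q, hqK, hq⟩ := hJK
      obtain ⟨_, ⟨p', hp'B, rfl⟩, rfl⟩ := hqK
      obtain ⟨x', hx'q, hx'⟩ := 𝓜.exists_embed_between (hpast p') hq hfut
      have hqKc : χ (𝒮.embed p') ∈ Kc := mem_image_of_mem χ (mem_image_of_mem 𝒮.embed hp'B)
      have hx'B : x' ∈ B₀ :=
        LorentzianMetric.causalFuture_mono (singleton_subset_iff.2 hqKc) hx'q
      exact LorentzianMetric.causalFuture_mono
        (singleton_subset_iff.2 (mem_image_of_mem _ hx'B)) hx'
    -- Lebesgue measure scales by `λ` under `u ↦ u/λ − t₀`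
    have hvol : volume ((fun u ↦ lam⁻¹ * u + -t₀) ⁻¹' Tset) =
        ENNReal.ofReal lam * sojournTime γ dom
          (𝓜.metric.causalFuture 𝓜.timeOrientation (𝓜.embed '' B₀)) := by
      show volume ((fun u ↦ lam⁻¹ * u) ⁻¹' ((fun v ↦ v + -t₀) ⁻¹' Tset)) = _
      rw [Real.volume_preimage_mul_left hlam0, measure_preimage_add_right, inv_inv,
        abs_of_pos hlam]
      rfl
    have h1 : ENNReal.ofReal (c * s) ≤ ENNReal.ofReal lam * sojournTime γ dom
        (𝓜.metric.causalFuture 𝓜.timeOrientation (𝓜.embed '' B₀)) :=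
      h.trans ((measure_mono hsub).trans_eq hvol)
    have h2 : ENNReal.ofReal lam * ENNReal.ofReal s ≤ ENNReal.ofReal lam * sojournTime γ dom
        (𝓜.metric.causalFuture 𝓜.timeOrientation (𝓜.embed '' B₀)) := by
      refine le_trans ?_ h1
      rw [← ENNReal.ofReal_mul hlam.le]
      exact ENNReal.ofReal_le_ofReal (mul_le_mul_of_nonneg_right hlamc hs.le)
    exact (ENNReal.mul_le_mul_iff_right (ENNReal.ofReal_pos.2 hlam).ne' ENNReal.ofReal_ne_top).1 h2

/-- **The leaf transfer, stated over the leaf map and its normal.**  Same statement as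
`hasCompleteNullInfinity_of_leaf`, with the leaf `j = χ ∘ ι_S : N → 𝓜` and a normal field `ν_j`
along it satisfying `dχ (ν_S p) = ν_j p` displayed, so that the past clause, the foot points
`γ(−t₀) = j p`, the renormalisation `g(γ'(−t₀), ν_j p) = −λ` and the avoided sets `J⁺(j C)` are all
expressed through `(j, ν_j)` (the form consumed by the assembly of `stub_softShieldedScri`, where
`ν_j` is THE future unit normal of the leaf and `dχ ν_S = ν_j` is uniqueness of future unit
normals).  Christodoulou, CQG 16 (1999) A23, pp. A26–A27; Dafermos–Rodnianski arXiv:0811.0354,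
§2.6.2. [cite: Christodoulou1999, pp. A26–A27] -/
theorem hasCompleteNullInfinity_of_leaf_normal (𝓜 : CauchyDevelopment D) (𝒮 : DataEmbedding D')
    {χ : 𝒮.carrier → 𝓜.carrier} (hχ : ContMDiff (𝓡 4) (𝓡 4) ∞ χ)
    (hiso : 𝒮.metric.IsIsometricImmersion 𝓜.metric.toPseudoRiemannianMetric χ)
    (hτ : 𝒮.timeOrientation.PreservesTimeOrientation χ 𝓜.timeOrientation)
    {j : N → 𝓜.carrier} {νj : NormalField (𝓡 4) j} (hj : χ ∘ 𝒮.embed = j)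
    (hν : ∀ p : N, mfderiv (𝓡 4) (𝓡 4) χ (𝒮.embed p) (𝒮.normal p) = νj p)
    (hpast : ∀ p : N, j p ∈ 𝓜.metric.causalPast 𝓜.timeOrientation (range 𝓜.embed))
    {A : Set N} (h𝒮 : 𝒮.HasCompleteFutureNullInfinityFrom A)
    (hfoot : ∀ [𝓜.metric.HasLeviCivita], ∃ c : ℝ, 0 < c ∧ ∀ C : Set N, IsCompact C →
      ∃ K : Set X, IsCompact K ∧ ∀ x ∉ K, ∀ (γ : ℝ → 𝓜.carrier) (dom : Set ℝ),
        𝓜.metric.IsNormalisedNullRayFrom 𝓜.timeOrientation 𝓜.embed 𝓜.normal x γ dom →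
        ∃ (t₀ lam : ℝ) (p : N), 0 ≤ t₀ ∧ 0 < lam ∧ lam ≤ c ∧ p ∈ A ∧ p ∉ C ∧ -t₀ ∈ dom ∧
          γ (-t₀) = j p ∧
          𝓜.metric.val (j p) (velocity (𝓡 4) γ (-t₀)) (νj p) = -lam ∧
          ∀ t ∈ dom, -t₀ ≤ t → t < 0 →
            γ t ∉ 𝓜.metric.causalFuture 𝓜.timeOrientation (j '' C)) :
    Summit.FinalStateConjecture.HasCompleteNullInfinity 𝓜 := by
  subst hj
  refine hasCompleteNullInfinity_of_leaf 𝓜 𝒮 hχ hiso hτ hpast h𝒮 ?_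
  intro inst𝓜
  obtain ⟨c, hc, hC⟩ := hfoot
  refine ⟨c, hc, fun C hCc ↦ ?_⟩
  obtain ⟨K, hK, hKray⟩ := hC C hCc
  refine ⟨K, hK, fun x hx γ dom hγ ↦ ?_⟩
  obtain ⟨t₀, lam, p, ht₀, hlam, hlamc, hpA, hpC, ht₀dom, hfootpt, hnormval, havoid⟩ :=
    hKray x hx γ dom hγ
  refine ⟨t₀, lam, p, ht₀, hlam, hlamc, hpA, hpC, ht₀dom, hfootpt, ?_, fun t ht h₁ h₂ ↦ ?_⟩
  · rw [hν p]; exact hnormval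
  · rw [← image_comp]; exact havoid t ht h₁ h₂

end LeafTransfer

/-! ## Registered sub-goal -/

section Registered

/-- **Registered sub-goal `stub_softShieldedScri_leafTransfer` of stub `stub_softShieldedScri`**
(line `Sketch`, crux stmt-FinalStateConjecture-14986): the leaf transfer in the registered binder
form, whose foot-point hypothesis only BOUNDS the renormalisation pairing from below,
`−c ≤ g(γ'(−t₀), dχ ν_S p)`; its negativity is automatic — `γ'(−t₀)` is future null (future null
velocity propagates along the geodesic, `IsGeodesicOn.isNull_and_isFutureDirected_velocity`) and
`dχ ν_S p` is future timelike (`χ` is a time-orientation preserving isometric immersion), and a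
future causal vector pairs negatively with a future timelike one
(`TimeOrientation.IsFutureDirected.val_lt_zero`, O'Neill 1983, Ch. 5, Lemma 5.26 and p. 145) —, so
`hasCompleteNullInfinity_of_leaf` applies with `λ := −g(γ'(−t₀), dχ ν_S p) ∈ (0, c]`.
[cite: Christodoulou1999, pp. A26–A27] -/
theorem stub_softShieldedScri_leafTransfer : ∀ (X : Type) [TopologicalSpace X] [ChartedSpace E3 X] [IsManifold (𝓡 3) ∞ X] [ConnectedSpace X] (D : InitialDataSet (𝓡 3) X) (𝓜 : CauchyDevelopment D) (N : Type) [TopologicalSpace N] [ChartedSpace E3 N] [IsManifold (𝓡 3) ∞ N] [ConnectedSpace N] (D' : InitialDataSet (𝓡 3) N) (𝒮 : DataEmbedding D') (χ : 𝒮.carrier → 𝓜.carrier), ContMDiff (𝓡 4) (𝓡 4) ∞ χ → 𝒮.metric.IsIsometricImmersion 𝓜.metric.toPseudoRiemannianMetric χ → 𝒮.timeOrientation.PreservesTimeOrientation χ 𝓜.timeOrientation → ∀ (A : Set N), 𝒮.HasCompleteFutureNullInfinityFrom A → (∀ p : N, χ (𝒮.embed p) ∈ 𝓜.metric.causalPast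 𝓜.timeOrientation (Set.range 𝓜.embed)) → (∀ [𝓜.metric.HasLeviCivita], ∃ c : ℝ, 0 < c ∧ ∀ C : Set N, IsCompact C → ∃ K : Set X, IsCompact K ∧ ∀ x : X, x ∉ K → ∀ (γ : ℝ → 𝓜.carrier) (dom : Set ℝ), 𝓜.metric.IsNormalisedNullRayFrom 𝓜.timeOrientation 𝓜.embed 𝓜.normal x γ dom → ∃ p ∈ A, p ∉ C ∧ ∃ t₀ : ℝ, 0 ≤ t₀ ∧ -t₀ ∈ dom ∧ γ (-t₀) = χ (𝒮.embed p) ∧ -c ≤ 𝓜.metric.val (γ (-t₀)) (velocity (𝓡 4) γ (-t₀)) (mfderiv (𝓡 4) (𝓡 4) χ (𝒮.embed p) (𝒮.normal p)) ∧ ∀ t ∈ dom, -t₀ ≤ t → t < 0 → γ t ∉ 𝓜.metric.causalFuture 𝓜.timeOrientation (χ '' (𝒮.embed '' C))) → Summit.FinalStateConjecture.HasCompleteNullInfinity 𝓜 :=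
  fun X _ _ _ _ D 𝓜 N _ _ _ _ D' 𝒮 χ hχ hiso hτ A h𝒮 hpast hfoot ↦ by
    refine hasCompleteNullInfinity_of_leaf 𝓜 𝒮 hχ hiso hτ hpast h𝒮 ?_
    intro inst𝓜
    haveI := contMDiffCovariantDerivative_leviCivita 𝓜
    obtain ⟨c, hc, hC⟩ := hfoot
    refine ⟨c, hc, fun C hCc ↦ ?_⟩
    obtain ⟨K, hK, hKray⟩ := hC C hCc
    refine ⟨K, hK, fun x hx γ dom hγ ↦ ?_⟩
    obtain ⟨p, hpA, hpC, t₀, ht₀, ht₀dom, hfootpt, hval, havoid⟩ := hKray x hx γ dom hγ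
    -- `γ'(−t₀)` is future null
    have hmax := hγ.isMaximalGeodesicOn
    have hnf := IsGeodesicOn.isNull_and_isFutureDirected_velocity 𝓜.metric 𝓜.timeOrientation
      hmax.isOpen hmax.2.1 hmax.isGeodesicOn hγ.zero_mem hγ.isNull_velocity
      hγ.isFutureDirected_velocity ht₀dom
    -- `dχ ν_S p` is future timelike
    have hvalχ : ∀ (y : 𝒮.carrier) (u u' : TangentSpace (𝓡 4) y), 𝒮.metric.val y u u' =
        𝓜.metric.val (χ y) (mfderiv (𝓡 4) (𝓡 4) χ y u) (mfderiv (𝓡 4) (𝓡 4) χ y u') :=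
      fun y u u' ↦ by
        have h := congrArg (fun b ↦ b u u') (hiso.2 y)
        simpa only [pullbackBilin_apply] using h.symm
    have hTt : 𝓜.metric.IsTimelike (x := χ (𝒮.embed p))
        (mfderiv (𝓡 4) (𝓡 4) χ (𝒮.embed p) (𝒮.normal p)) := by
      show 𝓜.metric.val _ _ _ < 0
      rw [← hvalχ, 𝒮.isFutureUnitNormal.1.2 p]
      norm_num
    have hTf : 𝓜.timeOrientation.IsFutureDirected (x := χ (𝒮.embed p))
        (mfderiv (𝓡 4) (𝓡 4) χ (𝒮.embed p) (𝒮.normal p)) :=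
      hτ.isFutureDirected_mfderiv hiso.2 (𝒮.isFutureUnitNormal.2 p)
    -- hence the pairing is negative, and `λ := −g(γ'(−t₀), dχ ν_S p) ∈ (0, c]`
    have key : ∀ (y : 𝓜.carrier) (_ : y = χ (𝒮.embed p)) (v : TangentSpace (𝓡 4) y),
        𝓜.timeOrientation.IsFutureDirected v →
        -c ≤ 𝓜.metric.val y v (mfderiv (𝓡 4) (𝓡 4) χ (𝒮.embed p) (𝒮.normal p)) →
        ∃ lam : ℝ, 0 < lam ∧ lam ≤ c ∧
          𝓜.metric.val (χ (𝒮.embed p)) v (mfderiv (𝓡 4) (𝓡 4) χ (𝒮.embed p) (𝒮.normal p)) =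
            -lam := by
      rintro y rfl v hv hcv
      have hneg : 𝓜.metric.val (χ (𝒮.embed p))
          (mfderiv (𝓡 4) (𝓡 4) χ (𝒮.embed p) (𝒮.normal p)) v < 0 :=
        TimeOrientation.IsFutureDirected.val_lt_zero 𝓜.timeOrientation hTf hTt hv
      rw [𝓜.metric.symm] at hneg
      exact ⟨-𝓜.metric.val (χ (𝒮.embed p)) v (mfderiv (𝓡 4) (𝓡 4) χ (𝒮.embed p) (𝒮.normal p)),
        by linarith, by linarith, by ring⟩
    obtain ⟨lam, hlam, hlamc, hnormval⟩ := key _ hfootpt _ hnf.2 hval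
    exact ⟨t₀, lam, p, ht₀, hlam, hlamc, hpA, hpC, ht₀dom, hfootpt, hnormval, havoid⟩

end Registered

end SoftShieldedScri

end Summit.FinalStateConjecture.FinalStateConjecture.Theorems.CaptureSufficesC2.Sketch

end
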